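import Summits.BirchSwinnertonDyer.BirchSwinnertonDyer.Theorems.EisensteinPrimesMazurMCOnX1RankZeroMuEtaleEnd
import Summits.BirchSwinnertonDyer.BirchSwinnertonDyer.Theorems.EisensteinPrimesMazurMCOnCellBAnalyticMuOffLocus
import Summits.BirchSwinnertonDyer.BirchSwinnertonDyer.Theorems.EisensteinPrimesMazurMCOnCellBCongruenceRoadMuPart
import Summits.BirchSwinnertonDyer.Rank1Residual.GreenbergMuConjecture
import Summits.BirchSwinnertonDyer.Rank1Residual.X2.CongruenceTransfer
import Literature.NumberTheory.EllipticCurves.GlobalMinimalModelProofs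
import Literature.NumberTheory.EllipticCurves.IsogenyVariableChangeProofs
import Literature.Barriers.BirchSwinnertonDyer.EisensteinMuConjecture
import HarnessLib

/-!
# Crux `MazurMCOnCellB` (stmt-BirchSwinnertonDyer-19033), line `mudescent`, stub
# `stub_analyticMuZero_offLocus` — the ALGEBRAIC `μ` is LOCATED at the étale end of an X2b class,
# and the registered stub is Greenberg's Conjecture 1.11 (the typing layer's leaf
# `Rank1Residual.GreenbergMuConjecture`, BY NAME) on the X2b classes modulo the `μ`-part of Mazur's
# main conjecture at the étale ends (cell `bsd-eis`, width seat `bsd-line-x2-p1-w2` g0, D-0154 row 5;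
# CONSTRUCTION stub, open-problem grade — closes NO stub)

The X2b (= `X2.CellB`: analytic rank `0`, odd MULTIPLICATIVE Eisenstein prime, `¬ GVPar`) twin of the
rank-`0` X1 files `…MazurMCOnX1RankZeroMuEtaleEnd` (p471995) / `…MazurMCOnX1RankZeroGreenbergMuShape`
(p473343, bsd-eis mu-b) and of the typing layer's edge
`Rank1Residual.GreenbergMu.stub_analyticMuZero_offLocus_of_greenbergMuConjecture_of_muPart`, which exist
for crux 5 only. Reused generic kernels of p471995: `μ(X(E/ℚ_∞))` is invariant under isogenies of
degree prime to `p` (`mu_eq_of_isogeny_not_dvd_degree`); two globally minimal members all of whose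
rational `p`-lines are unramified, at an odd good-ordinary OR MULTIPLICATIVE `p`, are related by an
isogeny of degree prime to `p` (`exists_isogeny_not_dvd_degree_of_forall_lineUnramifiedAt`).

WHAT THIS FILE PROVES (theorems only; no `def`, no new named fact, no `sorry`):
* §1 `mu_eq_of_offLocus_of_offLocus` — two OFF-LOCUS members of an X2b class have the same algebraic
  `μ` for every cyclotomic dual datum (no named fact; `CellB` transports by `X2.cellB_iff_of_isIsogenous`).
* §2 (granted Greenberg Prop. 5.7 `h57`, Wuthrich 2014 Thm. 16 `hWu`, modularity `hmod`)
  `not_hasRamifiedOddLineAt_of_forall_mu_eq_zero` (a `μ = 0` member is off the locus — the barrier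
  `EisensteinMuBarrier` contrapositively, torsion by Kato–Wuthrich), `mu_eq_zero_offLocus_of_exists_member`
  (ONE `μ = 0` member ⇒ `μ = 0` at every off-locus member), `mu_eq_zero_iff_not_hasRamifiedOddLineAt_of_exists_member`
  (in a class holding a `μ = 0` member the `μ = 0` members are EXACTLY the off-locus ones — Greenberg,
  LNM 1716 p. 58 «the above conjecture effectively predicts the value of `μ_E`», value `0`, on row A10).
* §3 Greenberg's Conj. 1.11 on X2b: `mu_eq_zero_offLocus_of_greenbergMuShape` (the leaf's exact body
  as displayed `hG` gives `μ = 0` at every off-locus X2b member; the shape differences — `W′` merely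
  elliptic, `D.IsTorsion →`, `W′` depending on `(κ, γ, D)` — discharged as in p473343 via a global
  minimal model `C • W′`, the degree-`1` isogeny `VariableChange.toIsogeny`, Kato–Wuthrich torsion, §2)
  and `greenbergMu_located_iff_isogenyForm` (located ⟺ isogeny form, via the LANDED `stub_locate`).
* §4 THE STUB AND THE LEAF, BY NAME: `stub_of_greenbergMuConjecture_of_mazurMainConjectureAt_offLocus`
  (`GreenbergMuConjecture` + `X2.MazurMainConjectureAt` at the off-locus X2b members — the `μ`-part
  carrier, mu-c p469882 §2, a consequence of the crux — ⇒ the registered signature VERBATIM);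
  `greenbergMuConjecture_onCellB_of_stub` (converse: the stub gives the leaf's conclusion at every X2b
  pair); `stub_iff_greenbergMu_of_mazurMCOnCellB` (UNDER the crux's conclusion at every X2b pair, the
  stub is EQUIVALENT to Greenberg's conjecture, isogeny form with globally minimal witness, on X2b).

HONEST FRAMING: nothing here proves the stub or the crux; `GreenbergMuConjecture` is an OPEN
`@[conjecture]` leaf taken as a displayed hypothesis (conditional bookkeeping, `--supports` helper);
`h57` / `hWu` / `hmod` are published named facts as in the sibling files; no label, count or tier of
the cell moves; BSD is proved for no curve. The file settles WHERE the open content of stub 3 lives: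
Greenberg's `μ`-conjecture on X2b (leaf, by name) glued to the `μ`-part of the main conjecture at the
étale end — the algebraic twin and by-name edge of mu-a's analytic record (p464487 §3) on crux 3.
References: [GreenbergLNM1716] Conj. 1.11 and p. 58, Prop. 5.7 (p. 113); [Wuthrich2014] Thm. 16
(p. 397); [GreenbergVatsal2000] (1)–(2), Thm. (1.3); [SilvermanAEC2009] VIII.8.3, III.4.11, III.6.1;
[BCDTJAMS2001] Thm. A; HOME `run/shared/lean/pub/bsd-eis/` (ky-g8 card v3, mu-b-MEMO-2,
plan-g27/HOSTING-D0154.md §[19033]).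
-/

set_option autoImplicit false

-- `Summit.BirchSwinnertonDyer.BirchSwinnertonDyer.…`: the summit and its single sub-problem share a name (D-0017 layout).
set_option linter.dupNamespace false

noncomputable section

open scoped Classical

open WeierstrassCurve Field
  Literature.NumberTheory.EllipticCurves Literature.NumberTheory.EllipticCurves.Rank1Residual
  Literature.NumberTheory.EllipticCurves.ModularForms
  Literature.NumberTheory.EllipticCurves.Greenberg1999
  Literature.NumberTheory.EllipticCurves.Wuthrich2014
  Literature.Barriers.BirchSwinnertonDyer
  Summit.BirchSwinnertonDyer.Rank1Residual
  Summit.BirchSwinnertonDyer.BirchSwinnertonDyer.Theorems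
  Summit.BirchSwinnertonDyer.BirchSwinnertonDyer.Theorems.EisensteinPrimesMazurMCOnX1RankZeroMuEtaleEnd
  Summit.BirchSwinnertonDyer.BirchSwinnertonDyer.Theorems.EisensteinPrimesMazurMCOnCellBTypeAPeriodLadder
  Summit.BirchSwinnertonDyer.BirchSwinnertonDyer.Theorems.EisensteinPrimesMazurMCOnCellBAnalyticMuOffLocus
  Summit.BirchSwinnertonDyer.BirchSwinnertonDyer.Theorems.EisensteinPrimesMazurMCOnCellBCongruenceRoadMuPart

namespace Summit.BirchSwinnertonDyer.BirchSwinnertonDyer.Theorems.EisensteinPrimesMazurMCOnCellBMuEtaleEnd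

variable {W : WeierstrassCurve ℚ} [W.IsElliptic] [W.IsGloballyMinimal] {p : ℕ} [hp : Fact p.Prime]

/-! ## §1. Two off-locus members of an X2b class have the same algebraic `μ` (no named fact) -/

/-- `X2.CellB` is an isogeny-class property (wrapper around `X2.cellB_iff_of_isIsogenous`, Tate
uniformisation discharged). [cite: GreenbergVatsal2000, Thm. (1.3) and §2 p. 28] -/
theorem cellB_of_isIsogenous (hc : X2.CellB W p) {W' : WeierstrassCurve ℚ} [W'.IsElliptic]
    [W'.IsGloballyMinimal] (hiso : IsIsogenous W W') : X2.CellB W' p :=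
  (X2.cellB_iff_of_isIsogenous (p := p) TateCurve.Silverman1994_thmV53_tateUniformisation_holds
    TateCurve.Silverman1994_thmV53_corV54_tateUniformisation_holds hiso).mp hc

/-- **Two off-locus members of an X2b class are related by an isogeny of degree prime to `p`**
(uniqueness of the étale end at a multiplicative type-A prime): both members are type A
(`¬ GVPar`, a class property) and off the `μ`-barrier locus, so EVERY rational `p`-line of either is
unramified (`forall_lineUnramifiedAt_of_not_gvPar_of_not_hasRamifiedOddLineAt`), and p471995 §2
applies at the multiplicative prime. [cite: GreenbergLNM1716, Conj. 1.11 and the isogeny paragraph (p. 58)]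
[cite: SilvermanAEC2009, Cor. III.4.11 and Thm. III.6.1] -/
theorem exists_isogeny_not_dvd_degree_of_offLocus_of_offLocus (hc : X2.CellB W p)
    (hoff : ¬ HasRamifiedOddLineAt W p) {W' : WeierstrassCurve ℚ} [W'.IsElliptic] [W'.IsGloballyMinimal]
    (hiso : IsIsogenous W W') (hoff' : ¬ HasRamifiedOddLineAt W' p) :
    ∃ lam : Isogeny W W', ¬ p ∣ lam.degree := by
  obtain ⟨hp2, hred, hnpar⟩ := hyp_of_cellB hc
  obtain ⟨-, -, hnpar'⟩ := hyp_of_cellB (cellB_of_isIsogenous hc hiso)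
  exact exists_isogeny_not_dvd_degree_of_forall_lineUnramifiedAt hp2 hred
    (forall_lineUnramifiedAt_of_not_gvPar_of_not_hasRamifiedOddLineAt hnpar hoff)
    (forall_lineUnramifiedAt_of_not_gvPar_of_not_hasRamifiedOddLineAt hnpar' hoff') hiso

/-- **Two off-locus members of an X2b class have the same algebraic `μ`** (for every dual datum of
`Sel_{p^∞}(·/ℚ_∞)` over the same `(κ, γ)`; no torsion hypothesis, no named fact): the prime-to-`p`
isogeny of the previous theorem and `mu_eq_of_isogeny_not_dvd_degree` (p471995 §1: the `Λ`-linear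
duals of `Sel(φ)`, `Sel(φ̂)` compose to the unit `deg φ`). The X2b twin of p471995's
`mu_eq_of_offLocus_of_offLocus`. [cite: GreenbergLNM1716, §1 p. 58 (the isogeny paragraph) and Conj. 1.11] -/
theorem mu_eq_of_offLocus_of_offLocus (hc : X2.CellB W p) (hoff : ¬ HasRamifiedOddLineAt W p)
    {W' : WeierstrassCurve ℚ} [W'.IsElliptic] [W'.IsGloballyMinimal] (hiso : IsIsogenous W W')
    (hoff' : ¬ HasRamifiedOddLineAt W' p) {κ : ZpExtension ℚ p} {γ : absoluteGaloisGroup ℚ}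
    (D : W.SelmerDualData κ γ) (D' : W'.SelmerDualData κ γ) : D'.mu = D.mu := by
  obtain ⟨lam, hlam⟩ := exists_isogeny_not_dvd_degree_of_offLocus_of_offLocus hc hoff hiso hoff'
  exact mu_eq_of_isogeny_not_dvd_degree lam hlam D D'

/-! ## §2. A `μ = 0` member is off the locus; `μ = 0` propagates to every off-locus member -/

/-- **Every cyclotomic dual datum of an X2b curve is `Λ`-torsion** (Kato–Wuthrich, `hWu` = Wuthrich
2014 Thm. 16 clause (1); newform and Néron normalisation `ϖ` from a modular parametrisation `hmod`).
[cite: Wuthrich2014, Thm. 16 and §5 (p. 397)] [cite: BCDTJAMS2001, Theorem A] -/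
theorem isTorsion_of_cellB (hWu : thm16_charIdeal_dvd_multiplicative_of_reducible)
    (hmod : nonempty_modularParametrizationData) (hc : X2.CellB W p)
    {κ : ZpExtension ℚ p} {γ : absoluteGaloisGroup ℚ} (hκ : κ.IsCyclotomic)
    (hγ : κ.IsTopGenerator γ) (hγ' : IsCyclotomicVariable p γ) (D : W.SelmerDualData κ γ) :
    D.IsTorsion := by
  haveI : NeZero (W.conductorNorm ℤ) := ⟨(W.conductorNorm_pos_holds).ne'⟩
  obtain ⟨Dm⟩ := hmod W
  obtain ⟨ϖ, -, hϖ, -⟩ := Dm.exists_rat_mul_realPeriodRat_eq_plusPeriod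
  exact hWu.isTorsion W p hc.2.1.1 hc.2.1.2.2 hc.2.1.2.1 hκ hγ hγ' Dm.isNewformOf D ϖ hϖ

/-- **A member with `μ = 0` (for all cyclotomic data matching the cyclotomic variable) is OFF the
`μ`-barrier locus** — Greenberg Prop. 5.7 (`h57`, via the barrier decl `EisensteinMuBarrier`) read
contrapositively at an odd multiplicative Eisenstein prime, torsion from Kato–Wuthrich (`hWu`, `hmod`).
The algebraic twin of mu-a's `not_hasRamifiedOddLineAt_of_analyticMuLE_zero` (p465613).
[cite: GreenbergLNM1716, Prop. 5.7 (p. 113)] [cite: Wuthrich2014, Thm. 16 (p. 397)] -/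
theorem not_hasRamifiedOddLineAt_of_forall_mu_eq_zero (h57 : prop57_one_le_mu_of_ramified_odd_line)
    (hWu : thm16_charIdeal_dvd_multiplicative_of_reducible) (hmod : nonempty_modularParametrizationData)
    (hc : X2.CellB W p)
    (hG : ∀ (κ : ZpExtension ℚ p) (γ : absoluteGaloisGroup ℚ),
      κ.IsCyclotomic → κ.IsTopGenerator γ → IsCyclotomicVariable p γ →
      ∀ D : W.SelmerDualData κ γ, D.mu = 0) :
    ¬ HasRamifiedOddLineAt W p := by
  intro hloc
  obtain ⟨κ, hκ, γ, hγ, hγ'⟩ := exists_isCyclotomic_isTopGenerator_isCyclotomicVariable_holds p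
  obtain ⟨D⟩ := W.nonempty_selmerDualData_holds κ γ hγ
  haveI : Module.Finite (IwasawaAlgebra p) D.X := D.module_finite_holds hγ
  exact EisensteinMuBarrier.mu_ne_zero h57 hc.2.1.1 (Or.inr hc.2.1.2.2) hloc hκ hγ D
    (isTorsion_of_cellB hWu hmod hc hκ hγ hγ' D) (hG κ γ hκ hγ hγ' D)

/-- **`μ = 0` at ONE member ⇒ `μ = 0` at every OFF-LOCUS member of its X2b class** (granted Prop. 5.7,
Wuthrich Thm. 16, modularity): the `μ = 0` member `W′` is X2b (`cellB_of_isIsogenous`) and off the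
locus (`not_hasRamifiedOddLineAt_of_forall_mu_eq_zero`), then §1. This is «(G_iso) ⇒ (G_loc)» on X2b
WITHOUT the `μ`-part of the main conjecture and without Schneider's / Perrin-Riou's isogeny formula.
[cite: GreenbergLNM1716, Conj. 1.11 (p. 58) and Prop. 5.7 (p. 113)] [cite: Wuthrich2014, Thm. 16 (p. 397)] -/
theorem mu_eq_zero_offLocus_of_exists_member (h57 : prop57_one_le_mu_of_ramified_odd_line)
    (hWu : thm16_charIdeal_dvd_multiplicative_of_reducible) (hmod : nonempty_modularParametrizationData)
    (hc : X2.CellB W p) (hoff : ¬ HasRamifiedOddLineAt W p) {W' : WeierstrassCurve ℚ} [W'.IsElliptic]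
    [W'.IsGloballyMinimal] (hiso : IsIsogenous W W')
    (hG' : ∀ (κ : ZpExtension ℚ p) (γ : absoluteGaloisGroup ℚ),
      κ.IsCyclotomic → κ.IsTopGenerator γ → IsCyclotomicVariable p γ →
      ∀ D' : W'.SelmerDualData κ γ, D'.mu = 0)
    {κ : ZpExtension ℚ p} {γ : absoluteGaloisGroup ℚ} (hκ : κ.IsCyclotomic)
    (hγ : κ.IsTopGenerator γ) (hγ' : IsCyclotomicVariable p γ) (D : W.SelmerDualData κ γ) :
    D.mu = 0 := by
  have hoff' : ¬ HasRamifiedOddLineAt W' p :=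
    not_hasRamifiedOddLineAt_of_forall_mu_eq_zero h57 hWu hmod (cellB_of_isIsogenous hc hiso) hG'
  obtain ⟨D'⟩ := W'.nonempty_selmerDualData_holds κ γ hγ
  rw [← mu_eq_of_offLocus_of_offLocus hc hoff hiso hoff' D D']
  exact hG' κ γ hκ hγ hγ' D'

/-- **In an X2b class holding ONE member with `μ(X) = 0`, the members with `μ(X) = 0` are EXACTLY the
off-locus members** (granted Prop. 5.7, Thm. 16, modularity): for `W′ ∼ W` with `μ(X(W′/ℚ_∞)) = 0`
for all cyclotomic data, `(∀ cyclotomic data, μ(X(W/ℚ_∞)) = 0) ↔ ¬ HasRamifiedOddLineAt W p`.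
Greenberg, LNM 1716 p. 58: «the above conjecture effectively predicts the value of `μ_E`» — for the
value `0`, a theorem on row A10. [cite: GreenbergLNM1716, Conj. 1.11 (p. 58) and Prop. 5.7 (p. 113)]
[cite: Wuthrich2014, Thm. 16 (p. 397)] -/
theorem mu_eq_zero_iff_not_hasRamifiedOddLineAt_of_exists_member
    (h57 : prop57_one_le_mu_of_ramified_odd_line)
    (hWu : thm16_charIdeal_dvd_multiplicative_of_reducible) (hmod : nonempty_modularParametrizationData)
    (hc : X2.CellB W p) {W' : WeierstrassCurve ℚ} [W'.IsElliptic] [W'.IsGloballyMinimal]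
    (hiso : IsIsogenous W W')
    (hG' : ∀ (κ : ZpExtension ℚ p) (γ : absoluteGaloisGroup ℚ),
      κ.IsCyclotomic → κ.IsTopGenerator γ → IsCyclotomicVariable p γ →
      ∀ D' : W'.SelmerDualData κ γ, D'.mu = 0) :
    (∀ (κ : ZpExtension ℚ p) (γ : absoluteGaloisGroup ℚ),
        κ.IsCyclotomic → κ.IsTopGenerator γ → IsCyclotomicVariable p γ →
        ∀ D : W.SelmerDualData κ γ, D.mu = 0) ↔ ¬ HasRamifiedOddLineAt W p :=
  ⟨not_hasRamifiedOddLineAt_of_forall_mu_eq_zero h57 hWu hmod hc,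
    fun hoff _ _ hκ hγ hγ' D ↦
      mu_eq_zero_offLocus_of_exists_member h57 hWu hmod hc hoff hiso hG' hκ hγ hγ' D⟩

/-! ## §3. Greenberg's Conjecture 1.11 on the X2b classes: the leaf's shape, located ⟺ isogeny form -/

/-- **Greenberg's Conj. 1.11, in the EXACT shape of the typing layer's leaf `GreenbergMuConjecture`
(displayed as `hG`; OPEN — nothing asserted), gives `μ = 0` at every off-locus X2b member** (granted
Prop. 5.7, Wuthrich Thm. 16, modularity): `D₀` is torsion (Kato–Wuthrich); `hG` yields an isogenous
elliptic `W′` with `μ = 0` on torsion data; its global minimal model `W″ = C • W′` (degree-`1` isogeny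
`VariableChange.toIsogeny`) is X2b with `μ(D″) = 0`, hence off the locus pointwise in `(κ, γ)`
(`EisensteinMuBarrier.mu_ne_zero`), hence `μ(D₀) = μ(D″) = 0` (§1). X2b twin of p473343.
[cite: GreenbergLNM1716, Conj. 1.11 (p. 58) and Prop. 5.7 (p. 113)] [cite: SilvermanAEC2009, VIII.8.3 and III.3.1(b)]
[cite: Wuthrich2014, Thm. 16 (p. 397)] -/
theorem mu_eq_zero_offLocus_of_greenbergMuShape (h57 : prop57_one_le_mu_of_ramified_odd_line)
    (hWu : thm16_charIdeal_dvd_multiplicative_of_reducible) (hmod : nonempty_modularParametrizationData)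
    (hG : ∀ (W : WeierstrassCurve ℚ) [W.IsElliptic] (p : ℕ) [Fact p.Prime]
      (κ : ZpExtension ℚ p) (γ : absoluteGaloisGroup ℚ),
      κ.IsCyclotomic → κ.IsTopGenerator γ →
      ∀ D : W.SelmerDualData κ γ, D.IsTorsion →
        ∃ (W' : WeierstrassCurve ℚ) (_ : W'.IsElliptic), W.IsIsogenous W' ∧
          ∀ D' : W'.SelmerDualData κ γ, D'.IsTorsion → D'.mu = 0)
    (W₀ : WeierstrassCurve ℚ) [W₀.IsElliptic] [W₀.IsGloballyMinimal] (p : ℕ) [Fact p.Prime]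
    (hc₀ : X2.CellB W₀ p) (hoff : ¬ HasRamifiedOddLineAt W₀ p)
    {κ : ZpExtension ℚ p} {γ : absoluteGaloisGroup ℚ} (hκ : κ.IsCyclotomic)
    (hγ : κ.IsTopGenerator γ) (hγ' : IsCyclotomicVariable p γ) (D₀ : W₀.SelmerDualData κ γ) :
    D₀.mu = 0 := by
  have hpP : p.Prime := Fact.out
  have hD₀ : D₀.IsTorsion := isTorsion_of_cellB hWu hmod hc₀ hκ hγ hγ' D₀
  obtain ⟨W', hE', hiso', hμ'⟩ := hG W₀ p κ γ hκ hγ D₀ hD₀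
  haveI := hE'
  -- a global minimal model `W'' = C • W'` and the degree-one isogeny `W' → W''`
  obtain ⟨C, hmin⟩ := hasGlobalMinimalModel_rat_holds W'
  haveI := hmin
  set ι : Isogeny W' (C • W') := VariableChange.toIsogeny W' C with hιdef
  have hιdeg : ¬ p ∣ ι.degree := by
    rw [hιdef, VariableChange.degree_toIsogeny]
    exact hpP.not_dvd_one
  have hiso'' : IsIsogenous W₀ (C • W') := hiso'.trans' ⟨ι⟩
  -- dual data for `W'` and `W''`, torsion and `μ = 0`
  obtain ⟨D'⟩ := W'.nonempty_selmerDualData_holds κ γ hγ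
  obtain ⟨D''⟩ := (C • W').nonempty_selmerDualData_holds κ γ hγ
  have hD' : D'.IsTorsion := (D₀.isTorsion_and_charIdeal_mul_span_eq_of_isIsogenous D' hiso' hγ hD₀).1
  obtain ⟨hD'', hμ''⟩ := isTorsion_and_mu_eq_of_isogeny_not_dvd_degree ι hιdeg hγ D' D'' hD'
  have hμ''0 : D''.mu = 0 := by rw [hμ'', hμ' D' hD']
  -- `W''` is X2b, off the locus (Prop. 5.7, pointwise in `(κ, γ)`)
  have hc'' : X2.CellB (C • W') p := cellB_of_isIsogenous hc₀ hiso''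
  haveI : Module.Finite (IwasawaAlgebra p) D''.X := D''.module_finite_holds hγ
  have hoff'' : ¬ HasRamifiedOddLineAt (C • W') p := fun hloc ↦
    EisensteinMuBarrier.mu_ne_zero h57 hc''.2.1.1 (Or.inr hc''.2.1.2.2) hloc hκ hγ D'' hD'' hμ''0
  -- two off-locus members have the same `μ`
  rw [← mu_eq_of_offLocus_of_offLocus hc₀ hoff hiso'' hoff'' D₀ D'', hμ''0]

/-- **Greenberg's conjecture on X2b, located form ⟺ isogeny form** (granted Prop. 5.7, Thm. 16,
modularity; NOT the `μ`-part of the main conjecture, NOT Schneider's formula): «`μ = 0` for every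
cyclotomic dual datum at every off-locus X2b member» ⟺ «every X2b class has a globally minimal member
with `μ = 0` for every cyclotomic dual datum». «⇒» by the LANDED `stub_locate` (p443911); «⇐» §2.
The X2b twin of p471995's `greenbergMu_located_iff_isogenyForm`.
[cite: GreenbergLNM1716, Conj. 1.11 (p. 58) and Prop. 5.7 (p. 113)] [cite: Wuthrich2014, Thm. 16 (p. 397)] -/
theorem greenbergMu_located_iff_isogenyForm (h57 : prop57_one_le_mu_of_ramified_odd_line)
    (hWu : thm16_charIdeal_dvd_multiplicative_of_reducible) (hmod : nonempty_modularParametrizationData) :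
    (∀ (W₀ : WeierstrassCurve ℚ) [W₀.IsElliptic] [W₀.IsGloballyMinimal] (p : ℕ) [Fact p.Prime],
      X2.CellB W₀ p → ¬ HasRamifiedOddLineAt W₀ p →
      ∀ (κ : ZpExtension ℚ p) (γ : absoluteGaloisGroup ℚ),
        κ.IsCyclotomic → κ.IsTopGenerator γ → IsCyclotomicVariable p γ →
        ∀ D : W₀.SelmerDualData κ γ, D.mu = 0) ↔
    (∀ (W : WeierstrassCurve ℚ) [W.IsElliptic] [W.IsGloballyMinimal] (p : ℕ) [Fact p.Prime],
      X2.CellB W p → ∃ (W' : WeierstrassCurve ℚ) (_ : W'.IsElliptic) (_ : W'.IsGloballyMinimal),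
        IsIsogenous W W' ∧ ∀ (κ : ZpExtension ℚ p) (γ : absoluteGaloisGroup ℚ),
          κ.IsCyclotomic → κ.IsTopGenerator γ → IsCyclotomicVariable p γ →
          ∀ D' : W'.SelmerDualData κ γ, D'.mu = 0) := by
  constructor
  · intro hloc W _ _ p _ hc
    obtain ⟨W₀, hW₀, hW₀', hiso, hoff⟩ := EisensteinPrimesMazurMCOnCellBLocate.stub_locate W p hc
    exact ⟨W₀, hW₀, hW₀', hiso, hloc W₀ p (cellB_of_isIsogenous hc hiso) hoff⟩
  · intro hiso W₀ _ _ p _ hc₀ hoff κ γ hκ hγ hγ' D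
    obtain ⟨W', _, _, hiso', hG'⟩ := hiso W₀ p hc₀
    exact mu_eq_zero_offLocus_of_exists_member h57 hWu hmod hc₀ hoff hiso' hG' hκ hγ hγ' D

/-- **The leaf's shape ⇒ the isogeny form on X2b with a GLOBALLY MINIMAL witness and NO torsion
guard** (granted Prop. 5.7, Thm. 16, modularity). [cite: GreenbergLNM1716, Conj. 1.11 (p. 58)] [cite: Wuthrich2014, Thm. 16 (p. 397)] -/
theorem greenbergMu_isogenyForm_onCellB_of_greenbergMuShape (h57 : prop57_one_le_mu_of_ramified_odd_line)
    (hWu : thm16_charIdeal_dvd_multiplicative_of_reducible) (hmod : nonempty_modularParametrizationData)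
    (hG : ∀ (W : WeierstrassCurve ℚ) [W.IsElliptic] (p : ℕ) [Fact p.Prime]
      (κ : ZpExtension ℚ p) (γ : absoluteGaloisGroup ℚ),
      κ.IsCyclotomic → κ.IsTopGenerator γ →
      ∀ D : W.SelmerDualData κ γ, D.IsTorsion →
        ∃ (W' : WeierstrassCurve ℚ) (_ : W'.IsElliptic), W.IsIsogenous W' ∧
          ∀ D' : W'.SelmerDualData κ γ, D'.IsTorsion → D'.mu = 0)
    (W : WeierstrassCurve ℚ) [W.IsElliptic] [W.IsGloballyMinimal] (p : ℕ) [Fact p.Prime]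
    (hc : X2.CellB W p) :
    ∃ (W' : WeierstrassCurve ℚ) (_ : W'.IsElliptic) (_ : W'.IsGloballyMinimal),
      IsIsogenous W W' ∧ ∀ (κ : ZpExtension ℚ p) (γ : absoluteGaloisGroup ℚ),
        κ.IsCyclotomic → κ.IsTopGenerator γ → IsCyclotomicVariable p γ →
        ∀ D' : W'.SelmerDualData κ γ, D'.mu = 0 :=
  (greenbergMu_located_iff_isogenyForm h57 hWu hmod).mp
    (fun W₀ _ _ p _ hc₀ hoff _ _ hκ hγ hγ' D ↦
      mu_eq_zero_offLocus_of_greenbergMuShape h57 hWu hmod hG W₀ p hc₀ hoff hκ hγ hγ' D) W p hc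

/-! ## §4. The registered stub and the leaf `GreenbergMuConjecture`, BY NAME -/

/-- **`stub_analyticMuZero_offLocus` FROM THE LEAF AND THE `μ`-PART OF MAZUR'S MAIN CONJECTURE AT THE
ÉTALE ENDS** (`--conditional-on GreenbergMuConjecture`, kernel-exact up to (M)). Granted Prop. 5.7
(`h57`), Wuthrich Thm. 16 (`hWu`), modularity (`hmod`), `X2.MazurMainConjectureAt` at every OFF-LOCUS
X2b member (`hM`, a consequence of the crux; it carries the `μ`-part «`μ_an ≤ μ_alg`», mu-c p469882 §2)
and the leaf `Rank1Residual.GreenbergMuConjecture` BY NAME (`hG`; OPEN `@[conjecture]` def): the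
registered signature VERBATIM — `hG` ⇒ `μ(X(W₀/ℚ_∞)) = 0` (§3) ⇒ the generator `T^e g w` of `hM` has
`μ = 0`, i.e. a unit coefficient of `ϖ · L`. Conditional closure only.
[cite: GreenbergLNM1716, Conj. 1.11 (p. 58) and Prop. 5.7 (p. 113)] [cite: Wuthrich2014, Thm. 16 (p. 397)]
[cite: GreenbergVatsal2000, p. 2 (1)–(2)] -/
theorem stub_of_greenbergMuConjecture_of_mazurMainConjectureAt_offLocus
    (h57 : prop57_one_le_mu_of_ramified_odd_line)
    (hWu : thm16_charIdeal_dvd_multiplicative_of_reducible) (hmod : nonempty_modularParametrizationData)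
    (hM : ∀ (W₀ : WeierstrassCurve ℚ) [W₀.IsElliptic] [W₀.IsGloballyMinimal] (p : ℕ) [Fact p.Prime],
      X2.CellB W₀ p → ¬ HasRamifiedOddLineAt W₀ p → X2.MazurMainConjectureAt W₀ p)
    (hG : GreenbergMuConjecture) :
    ∀ (W₀ : WeierstrassCurve ℚ) [W₀.IsElliptic] [W₀.IsGloballyMinimal] (p : ℕ) [Fact p.Prime],
      X2.CellB W₀ p → ¬ HasRamifiedOddLineAt W₀ p → X2.AnalyticMuLE W₀ p 0 := by
  intro W₀ _ _ p _ hc₀ hoff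
  exact analyticMuLE_zero_of_mazurMainConjectureAt_of_forall_mu_eq_zero (hM W₀ p hc₀ hoff)
    fun _ _ hκ hγ hγ' D ↦ mu_eq_zero_offLocus_of_greenbergMuShape h57 hWu hmod hG W₀ p hc₀ hoff hκ hγ hγ' D

/-- **The same with the crux's conclusion at EVERY X2b pair as the `μ`-part carrier** (the shape
`∀ W p, X2.CellB W p → X2.MazurMainConjectureAt W p` is `MazurMCOnCellB` unfolded, stated without
importing the route file): `GreenbergMuConjecture` + (Mazur's main conjecture on X2b) ⇒ the stub.
So on line `mudescent` the crux and its own stub 3 differ EXACTLY by Greenberg's Conj. 1.11 on X2b.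
[cite: GreenbergLNM1716, Conj. 1.11 (p. 58)] [cite: Wuthrich2014, Thm. 16 (p. 397)] -/
theorem stub_of_greenbergMuConjecture_of_mazurMCOnCellB (h57 : prop57_one_le_mu_of_ramified_odd_line)
    (hWu : thm16_charIdeal_dvd_multiplicative_of_reducible) (hmod : nonempty_modularParametrizationData)
    (hMC : ∀ (W : WeierstrassCurve ℚ) [W.IsElliptic] [W.IsGloballyMinimal] (p : ℕ) [Fact p.Prime],
      X2.CellB W p → X2.MazurMainConjectureAt W p)
    (hG : GreenbergMuConjecture) :
    ∀ (W₀ : WeierstrassCurve ℚ) [W₀.IsElliptic] [W₀.IsGloballyMinimal] (p : ℕ) [Fact p.Prime],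
      X2.CellB W₀ p → ¬ HasRamifiedOddLineAt W₀ p → X2.AnalyticMuLE W₀ p 0 :=
  stub_of_greenbergMuConjecture_of_mazurMainConjectureAt_offLocus h57 hWu hmod
    (fun W₀ _ _ p _ hc₀ _ ↦ hMC W₀ p hc₀) hG

/-- **Conversely, the stub gives the leaf's conclusion at every X2b pair** (granted Thm. 16 and
modularity; no Prop. 5.7): for an X2b pair `(W, p)` and cyclotomic `(κ, γ)` matching the cyclotomic
variable, SOME `ℚ`-isogenous elliptic `W′` — the étale end of `stub_locate` (LANDED p443911) — has
`μ = 0` for every (torsion) dual datum: the conclusion of `GreenbergMuConjecture` for these `(E, p)`,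
witness independent of the datum; `μ_alg ≤ μ_an = 0` is Kato–Wuthrich
(`X2.isTorsion_and_mu_eq_zero_of_analyticMuLE_zero`). [cite: GreenbergLNM1716, Conj. 1.11 (p. 58)]
[cite: Wuthrich2014, Thm. 16 (p. 397)] [cite: GreenbergVatsal2000, p. 2, (2) and p. 4] -/
theorem greenbergMuConjecture_onCellB_of_stub (hWu : thm16_charIdeal_dvd_multiplicative_of_reducible)
    (hmod : nonempty_modularParametrizationData)
    (hstub : ∀ (W₀ : WeierstrassCurve ℚ) [W₀.IsElliptic] [W₀.IsGloballyMinimal] (p : ℕ) [Fact p.Prime],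
      X2.CellB W₀ p → ¬ HasRamifiedOddLineAt W₀ p → X2.AnalyticMuLE W₀ p 0)
    (W : WeierstrassCurve ℚ) [W.IsElliptic] [W.IsGloballyMinimal] (p : ℕ) [Fact p.Prime]
    (hc : X2.CellB W p) (κ : ZpExtension ℚ p) (γ : absoluteGaloisGroup ℚ) (hκ : κ.IsCyclotomic)
    (hγ : κ.IsTopGenerator γ) (hγ' : IsCyclotomicVariable p γ) :
    ∃ (W' : WeierstrassCurve ℚ) (_ : W'.IsElliptic), W.IsIsogenous W' ∧
      ∀ D' : W'.SelmerDualData κ γ, D'.IsTorsion → D'.mu = 0 := by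
  obtain ⟨W₀, hE₀, hmin₀, hiso, hoff⟩ := EisensteinPrimesMazurMCOnCellBLocate.stub_locate W p hc
  have hc₀ : X2.CellB W₀ p := cellB_of_isIsogenous hc hiso
  exact ⟨W₀, hE₀, hiso, fun D' _ ↦ (X2.isTorsion_and_mu_eq_zero_of_analyticMuLE_zero hWu hmod
    hc₀.2.1.1 hc₀.2.1.2.2 hc₀.2.1.2.1 (hstub W₀ p hc₀ hoff) hκ hγ hγ' D').2⟩

/-- **The stub ⇒ Greenberg's conjecture on X2b in the isogeny form with a GLOBALLY MINIMAL witness and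
`μ = 0` for ALL cyclotomic data** (granted Thm. 16 and modularity): the étale end of `stub_locate`.
[cite: GreenbergLNM1716, Conj. 1.11 (p. 58)] [cite: Wuthrich2014, Thm. 16 (p. 397)] -/
theorem greenbergMu_isogenyForm_onCellB_of_stub (hWu : thm16_charIdeal_dvd_multiplicative_of_reducible)
    (hmod : nonempty_modularParametrizationData)
    (hstub : ∀ (W₀ : WeierstrassCurve ℚ) [W₀.IsElliptic] [W₀.IsGloballyMinimal] (p : ℕ) [Fact p.Prime],
      X2.CellB W₀ p → ¬ HasRamifiedOddLineAt W₀ p → X2.AnalyticMuLE W₀ p 0)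
    (W : WeierstrassCurve ℚ) [W.IsElliptic] [W.IsGloballyMinimal] (p : ℕ) [Fact p.Prime]
    (hc : X2.CellB W p) :
    ∃ (W' : WeierstrassCurve ℚ) (_ : W'.IsElliptic) (_ : W'.IsGloballyMinimal),
      IsIsogenous W W' ∧ ∀ (κ : ZpExtension ℚ p) (γ : absoluteGaloisGroup ℚ),
        κ.IsCyclotomic → κ.IsTopGenerator γ → IsCyclotomicVariable p γ →
        ∀ D' : W'.SelmerDualData κ γ, D'.mu = 0 := by
  obtain ⟨W₀, hE₀, hmin₀, hiso, hoff⟩ := EisensteinPrimesMazurMCOnCellBLocate.stub_locate W p hc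
  have hc₀ : X2.CellB W₀ p := cellB_of_isIsogenous hc hiso
  exact ⟨W₀, hE₀, hmin₀, hiso, fun κ γ hκ hγ hγ' D' ↦ (X2.isTorsion_and_mu_eq_zero_of_analyticMuLE_zero
    hWu hmod hc₀.2.1.1 hc₀.2.1.2.2 hc₀.2.1.2.1 (hstub W₀ p hc₀ hoff) hκ hγ hγ' D').2⟩

/-- **UNDER THE CRUX, STUB 3 ⟺ GREENBERG'S CONJECTURE ON X2b.** Granted Prop. 5.7, Wuthrich Thm. 16,
modularity and Mazur's main conjecture at every X2b pair (`hMC` — the conclusion predicate of the crux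
`MazurMCOnCellB`, route file not imported): the registered `stub_analyticMuZero_offLocus` holds iff
every X2b class has a globally minimal member with `μ(X(·/ℚ_∞)) = 0` for all cyclotomic data — the
isogeny form of Greenberg's Conj. 1.11 on row A10. So what stub 3 adds to the crux is EXACTLY
Greenberg's `μ`-conjecture on X2b (ky g8 card v3 (B) 4, now a kernel `Iff`).
[cite: GreenbergLNM1716, Conj. 1.11 (p. 58) and Prop. 5.7 (p. 113)] [cite: Wuthrich2014, Thm. 16 (p. 397)] -/
theorem stub_iff_greenbergMu_of_mazurMCOnCellB (h57 : prop57_one_le_mu_of_ramified_odd_line)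
    (hWu : thm16_charIdeal_dvd_multiplicative_of_reducible) (hmod : nonempty_modularParametrizationData)
    (hMC : ∀ (W : WeierstrassCurve ℚ) [W.IsElliptic] [W.IsGloballyMinimal] (p : ℕ) [Fact p.Prime],
      X2.CellB W p → X2.MazurMainConjectureAt W p) :
    (∀ (W₀ : WeierstrassCurve ℚ) [W₀.IsElliptic] [W₀.IsGloballyMinimal] (p : ℕ) [Fact p.Prime],
      X2.CellB W₀ p → ¬ HasRamifiedOddLineAt W₀ p → X2.AnalyticMuLE W₀ p 0) ↔
    (∀ (W : WeierstrassCurve ℚ) [W.IsElliptic] [W.IsGloballyMinimal] (p : ℕ) [Fact p.Prime],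
      X2.CellB W p → ∃ (W' : WeierstrassCurve ℚ) (_ : W'.IsElliptic) (_ : W'.IsGloballyMinimal),
        IsIsogenous W W' ∧ ∀ (κ : ZpExtension ℚ p) (γ : absoluteGaloisGroup ℚ),
          κ.IsCyclotomic → κ.IsTopGenerator γ → IsCyclotomicVariable p γ →
          ∀ D' : W'.SelmerDualData κ γ, D'.mu = 0) := by
  refine ⟨fun hstub W _ _ p _ hc ↦ greenbergMu_isogenyForm_onCellB_of_stub hWu hmod hstub W p hc,
    fun hiso ↦ ?_⟩
  intro W₀ _ _ p _ hc₀ hoff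
  exact analyticMuLE_zero_of_mazurMainConjectureAt_of_forall_mu_eq_zero (hMC W₀ p hc₀)
    fun _ _ hκ hγ hγ' D ↦
      (greenbergMu_located_iff_isogenyForm h57 hWu hmod).mpr hiso W₀ p hc₀ hoff _ _ hκ hγ hγ' D

end Summit.BirchSwinnertonDyer.BirchSwinnertonDyer.Theorems.EisensteinPrimesMazurMCOnCellBMuEtaleEnd

end
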